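import Literature.Probability.RandomPlanarGeometry.SpinObservableShortTime
import Literature.Probability.Process.ItoCalculus
import HarnessLib

/-!
# Driving local martingales from the spin observable WITHOUT moment bounds

Topic `Literature/Probability/RandomPlanarGeometry` (family `crit-ising`); theorems only, no
definition of a named fact. Companion of `SpinObservableDrivingMartingales.lean` and
`SpinObservableShortTime.lean`.

Chelkak–Duminil-Copin–Hongler–Kemppainen–Smirnov, C. R. Math. 352 (2014), §3, extract the two
driving martingales `W_t`, `W_t² - 3t` of a subsequential scaling limit of the critical
spin-Ising interface from the martingale observable `M_{t∧τ}(z)` (eq. (5)) by "exchanging the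
asymptotic expansion with the conditional expectation", for which they invoke the finite
exponential moments of the driving process (their Thm. 3, from Kemppainen–Smirnov 2017,
Prop. 3.8). The tree's transcription (`Loewner.martingale_driver_of_spinObservable`,
`Loewner.martingale_driver_of_spinCylinderIdentity`) accordingly carries the hypothesis that the
running supremum of `|W|` on each `[0, t]` is dominated by some `M ∈ L³`.

This file PROVES that the moment hypothesis is unnecessary for the conclusion that matters —
the hypothesis format of Lévy's characterisation: **if the real and imaginary parts of the
time-limited spin observable `N^y = Loewner.spinObservableProcess W y` are martingales for all
large `y`, then `W/√3` is a continuous local martingale with quadratic variation `t`** (no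
integrability assumption on `W` at all). The point: localise at the far-field stopping time
`ρ_L = farStopTime W L` of a FIXED level `L` (before `ρ_L`, `|W| ≤ L/128` and `√t ≤ L/128`), and
let the level `y` of the observable tend to `∞` independently. Applied to the stopped driver
`W^{ρ_L}` with the constant bound `M = L/128` and to the rescaled observable martingales
`(y/L) Im N^y_{·∧ρ_L}`, `1 + (y/L)² (Re N^y_{·∧ρ_L} - 1)`, the general coefficient lemmas of
`SpinObservableDrivingMartingales.lean` (`Loewner.integral_abs_condExp_stoppedDriver_sub_le_of_coeff`,
`Loewner.integral_abs_condExp_stoppedQuad_sub_le_of_coeff`) have constants `K = 300 L²/y²`,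
resp. `300 L/y`, so their `L¹` defects tend to `0` as `y → ∞` while the stopped processes do not
move: `W^{ρ_L}` and `(W^{ρ_L})² - 3(· ∧ ρ_L)` are true martingales for every `L`, and
`ρ_{n+1} ↑ ∞` is a localizing sequence.

Results (all PROVED; `W` strongly adapted with continuous paths and `W_0 = 0` throughout):

* localisation by far-field stopping times: `Loewner.coe_zero_lt_farStopTime`,
  `Loewner.farStopTime_mono_level`, `Loewner.tendsto_farStopTime_nat_atTop`,
  `Loewner.isLocalizingSequence_farStopTime`; the stopped driver `W^{ρ_L}` is bounded by `L/128`
  (`Loewner.abs_stoppedProcess_farStopTime_le`) and its own far-field stopping time at level `L`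
  is `ρ_L` again (`Loewner.farStopTime_stoppedProcess_self`);
* `Loewner.martingale_stoppedDriver_of_spinObservable`,
  `Loewner.martingale_stoppedQuad_of_spinObservable` — the two stopped martingales at level `L`;
* `Loewner.isLocalMartingale_driver_of_spinObservable` — `W` and `W² - 3t` are local
  martingales; `Loewner.isLocalMartingale_hasQuadraticVariation_of_spinObservable` — Lévy's
  format for `X = W/√3`;
* `Loewner.isLocalMartingale_hasQuadraticVariation_of_spinCylinderIdentity` — the same from
  CDHKS's cylinder identity `E[(N^y_t - N^y_s) ψ(W_S)] = 0` in the natural filtration of `W`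
  (via `martingale_re_im_spinObservableProcess_of_cylinder`), i.e.
  `martingale_driver_of_spinCylinderIdentity` without its `L³` clause and with a local
  conclusion — which is all that `isSLELaw_of_isLocalMartingale_driving_of_lt_four`
  (`SLELawOfDrivingProcessLocal.lean`) consumes.

Consequence for crit-ising.S17 (spin): the identification of subsequential limits as SLE₃
(`LatticeModels/InterfaceSLELocal.lean`) no longer needs the exponential-moment statement of
CDHKS Thm. 3 / Kemppainen–Smirnov Prop. 3.8.

## References

* D. Chelkak, H. Duminil-Copin, C. Hongler, A. Kemppainen, S. Smirnov, *Convergence of Ising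
  interfaces to Schramm's SLE curves*, C. R. Math. Acad. Sci. Paris 352 (2014) 157–161
  (arXiv:1312.0533), §3, eq. (5) and the last paragraph.
* D. Revuz, M. Yor, *Continuous Martingales and Brownian Motion* (1999), Ch. IV, Def. (1.5),
  Prop. (1.7) (localisation), Thm. (3.6) (Lévy).
-/

noncomputable section

open Set Filter Topology Metric MeasureTheory Complex ProbabilityTheory
open scoped NNReal

namespace Literature.Probability.RandomPlanarGeometry

namespace Loewner

open Literature.Probability.Process

variable {Ω : Type*} {m : MeasurableSpace Ω} {W : ℝ≥0 → Ω → ℝ}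

/-! ### Localisation by the far-field stopping times -/

section Localisation

/-- For a positive level, the far-field stopping time is positive: at time `0` the level function
`128 (√0 + |W_0|)` vanishes (`W_0 = 0`). [folklore] -/
theorem coe_zero_lt_farStopTime (hWc : ∀ ω, Continuous (W · ω)) (hW0 : ∀ ω, W 0 ω = 0)
    {L : ℝ} (hL : 0 < L) (ω : Ω) : ((0 : ℝ≥0) : WithTop ℝ≥0) < farStopTime W L ω := by
  rw [lt_iff_not_ge]
  intro hle
  obtain ⟨j, hj, hjmem⟩ := (hittingAfter_zero_le_coe_iff (isClosed_farStopSet L)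
    (continuous_clockDriver hWc ω)).1 hle
  have hj0 : j = 0 := le_antisymm hj bot_le
  subst hj0
  simp only [farStopSet, clockDriver, mem_setOf_eq, hW0 ω, NNReal.coe_zero, Real.sqrt_zero,
    abs_zero, add_zero, mul_zero] at hjmem
  exact absurd hjmem (not_le.2 hL)

/-- `⊥ < ρ_L` (the form used by Mathlib's `ProbabilityTheory.Locally`). [folklore] -/
theorem bot_lt_farStopTime (hWc : ∀ ω, Continuous (W · ω)) (hW0 : ∀ ω, W 0 ω = 0)
    {L : ℝ} (hL : 0 < L) (ω : Ω) : (⊥ : WithTop ℝ≥0) < farStopTime W L ω :=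
  lt_of_le_of_lt bot_le (coe_zero_lt_farStopTime hWc hW0 hL ω)

/-- The far-field stopping times are monotone in the level. [folklore] -/
theorem farStopTime_mono_level (hWc : ∀ ω, Continuous (W · ω)) {L L' : ℝ} (hLL' : L ≤ L')
    (ω : Ω) : farStopTime W L ω ≤ farStopTime W L' ω := by
  induction h : farStopTime W L' ω with
  | top => exact le_top
  | coe T =>
    have hmem : clockDriver W T ω ∈ farStopSet L' :=
      mem_of_hittingAfter_zero_eq_coe (isClosed_farStopSet L') (continuous_clockDriver hWc ω) h
    refine (hittingAfter_zero_le_coe_iff (isClosed_farStopSet L)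
      (continuous_clockDriver hWc ω)).2 ⟨T, le_rfl, ?_⟩
    simp only [farStopSet, mem_setOf_eq] at hmem ⊢
    exact hLL'.trans hmem

/-- Along the integer levels the far-field stopping times tend to `⊤` (every `ω`): the level
function is bounded on each compact time interval (`exists_forall_lt_farStopTime`). [folklore] -/
theorem tendsto_farStopTime_nat_atTop (hWc : ∀ ω, Continuous (W · ω)) (ω : Ω) :
    Tendsto (fun n : ℕ ↦ farStopTime W ((n : ℝ) + 1) ω) atTop (𝓝 ⊤) := by
  rw [tendsto_order]
  refine ⟨fun a ha ↦ ?_, fun a ha ↦ absurd ha (not_lt.2 le_top)⟩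
  obtain ⟨t, rfl⟩ := WithTop.ne_top_iff_exists.1 ha.ne
  obtain ⟨Y, hY⟩ := exists_forall_lt_farStopTime hWc ω t
  obtain ⟨N, hN⟩ := exists_nat_ge Y
  refine eventually_atTop.2 ⟨N, fun n hn ↦ hY _ ?_⟩
  have : (N : ℝ) ≤ n := by exact_mod_cast hn
  linarith

variable {𝓕 : Filtration ℝ≥0 m} {P : Measure Ω}

/-- **The far-field stopping times `ρ_{n+1}`, `n ∈ ℕ`, form a localizing sequence** (stopping
times, monotone, tending to `⊤` everywhere). [folklore] -/
theorem isLocalizingSequence_farStopTime (hWad : StronglyAdapted 𝓕 W)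
    (hWc : ∀ ω, Continuous (W · ω)) :
    IsLocalizingSequence 𝓕 (fun n : ℕ ↦ farStopTime W ((n : ℝ) + 1)) P where
  isStoppingTime n := isStoppingTime_farStopTime hWad hWc _
  tendsto_top := ae_of_all _ fun ω ↦ tendsto_farStopTime_nat_atTop hWc ω
  mono := ae_of_all _ fun ω m n hmn ↦ farStopTime_mono_level hWc (by
    have : (m : ℝ) ≤ n := Nat.cast_le.2 hmn
    linarith) ω

end Localisation

/-! ### The driver stopped at a fixed level -/

section StoppedDriver

/-- **Before `ρ_L` the driver is bounded by `L/128` and the clock by `(L/128)²`**: for every `u`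
with `u ≤ ρ_L(ω)`, `|W_u(ω)| ≤ L/128` and `√u ≤ L/128`. [folklore] -/
theorem abs_le_and_sqrt_le_of_le_farStopTime (hWc : ∀ ω, Continuous (W · ω))
    (hW0 : ∀ ω, W 0 ω = 0) {L : ℝ} (hL : 0 < L) {ω : Ω} {u : ℝ≥0}
    (hu : (u : WithTop ℝ≥0) ≤ farStopTime W L ω) :
    |W u ω| ≤ L / 128 ∧ Real.sqrt u ≤ L / 128 := by
  have h := level_le_of_le_farStopTime hWc hW0 hL hu
  have h1 := abs_nonneg (W u ω)
  have h2 := Real.sqrt_nonneg (u : ℝ)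
  constructor
  · rw [le_div_iff₀ (by norm_num : (0 : ℝ) < 128)]; linarith
  · rw [le_div_iff₀ (by norm_num : (0 : ℝ) < 128)]; linarith

/-- The stopped driver `W^{ρ_L}` is bounded by `L/128`, at all times and all `ω`. [folklore] -/
theorem abs_stoppedProcess_farStopTime_le (hWc : ∀ ω, Continuous (W · ω))
    (hW0 : ∀ ω, W 0 ω = 0) {L : ℝ} (hL : 0 < L) (r : ℝ≥0) (ω : Ω) :
    |stoppedProcess W (farStopTime W L) r ω| ≤ L / 128 :=
  (abs_le_and_sqrt_le_of_le_farStopTime hWc hW0 hL (coe_untopA_min_le r _)).1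

/-- The stopped driver has continuous paths. [folklore] -/
theorem continuous_stoppedProcess_farStopTime (hWc : ∀ ω, Continuous (W · ω)) (L : ℝ) (ω : Ω) :
    Continuous fun r ↦ stoppedProcess W (farStopTime W L) r ω :=
  continuous_stoppedProcess_path (hWc ω) _

/-- The stopped driver starts at `0`. [folklore] -/
theorem stoppedProcess_farStopTime_zero (hW0 : ∀ ω, W 0 ω = 0) (L : ℝ) (ω : Ω) :
    stoppedProcess W (farStopTime W L) 0 ω = 0 := by
  rw [stoppedProcess_eq_of_le (by exact_mod_cast bot_le)]
  exact hW0 ω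

variable {𝓕 : Filtration ℝ≥0 m}

/-- The stopped driver is strongly adapted. [folklore] -/
theorem stronglyAdapted_stoppedProcess_farStopTime (hWad : StronglyAdapted 𝓕 W)
    (hWc : ∀ ω, Continuous (W · ω)) (L : ℝ) :
    StronglyAdapted 𝓕 (stoppedProcess W (farStopTime W L)) :=
  hWad.stoppedProcess hWc (isStoppingTime_farStopTime hWad hWc L)

/-- **The far-field stopping time of the stopped driver is the stopping time itself**:
`farStopTime (W^{ρ_L}) L = ρ_L` (the two paths agree up to `ρ_L`, where the closed stopping set
is reached). [folklore] -/
theorem farStopTime_stoppedProcess_self (hWc : ∀ ω, Continuous (W · ω)) (L : ℝ) (ω : Ω) :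
    farStopTime (stoppedProcess W (farStopTime W L)) L ω = farStopTime W L ω := by
  set ρ := farStopTime W L with hρ
  -- the clock–driver process of the stopped driver agrees with that of `W` up to `ρ`
  have hagree : ∀ j : ℝ≥0, (j : WithTop ℝ≥0) ≤ ρ ω →
      clockDriver (stoppedProcess W ρ) j ω = clockDriver W j ω := by
    intro j hj
    simp only [clockDriver, stoppedProcess_eq_of_le hj]
  induction h : ρ ω with
  | top =>
    -- `W` never reaches the stopping set, and the stopped driver is `W`
    refine hittingAfter_zero_apply_of_forall fun j hj ↦ ?_
    have hj' : clockDriver W j ω ∈ farStopSet L := by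
      rwa [hagree j (by rw [h]; exact le_top)] at hj
    have hlt : (j : WithTop ℝ≥0) < ρ ω := by rw [h]; exact WithTop.coe_lt_top j
    exact notMem_of_coe_lt_hittingAfter_zero hlt hj'
  | coe T =>
    have hmemT : clockDriver W T ω ∈ farStopSet L :=
      mem_of_hittingAfter_zero_eq_coe (isClosed_farStopSet L) (continuous_clockDriver hWc ω) h
    have hmemT' : clockDriver (stoppedProcess W ρ) T ω ∈ farStopSet L := by
      rwa [hagree T (by rw [h])]
    have hex : ∃ j, clockDriver (stoppedProcess W ρ) j ω ∈ farStopSet L := ⟨T, hmemT'⟩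
    change hittingAfter (clockDriver (stoppedProcess W ρ)) (farStopSet L) 0 ω = T
    rw [hittingAfter_zero_apply_of_exists hex, WithTop.coe_eq_coe]
    refine le_antisymm (csInf_le (OrderBot.bddBelow _) hmemT') (le_csInf hex fun j hj ↦ ?_)
    by_contra hlt
    rw [not_le] at hlt
    have hjρ : (j : WithTop ℝ≥0) < ρ ω := by rw [h]; exact WithTop.coe_lt_coe.2 hlt
    have hj' : clockDriver W j ω ∈ farStopSet L := by
      rw [mem_setOf_eq, hagree j hjρ.le] at hj
      exact hj
    exact notMem_of_coe_lt_hittingAfter_zero hjρ hj'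

/-- Consequently the stopped driver is its own stopped driver at level `L`, and its stopped clock
at level `L` is `r ∧ ρ_L`. [folklore] -/
theorem stoppedProcess_stoppedProcess_farStopTime (hWc : ∀ ω, Continuous (W · ω)) (L : ℝ)
    (r : ℝ≥0) (ω : Ω) :
    stoppedProcess (stoppedProcess W (farStopTime W L))
        (farStopTime (stoppedProcess W (farStopTime W L)) L) r ω =
      stoppedProcess W (farStopTime W L) r ω := by
  have h := farStopTime_stoppedProcess_self hWc L ω
  set ρ := farStopTime W L with hρdef
  set ρ' := farStopTime (stoppedProcess W ρ) L with hρ'def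
  simp only [stoppedProcess, h]
  -- `(r ∧ ρ) ∧ ρ = r ∧ ρ`
  have h1 : ((min (r : WithTop ℝ≥0) (ρ ω)).untopA : WithTop ℝ≥0) ≤ ρ ω := coe_untopA_min_le r _
  rw [min_eq_left h1, untopA_coe]

end StoppedDriver

/-! ### The far-field expansion at the doubly stopped clock -/

section Expansion

/-- **Far-field regime at the clock `r ∧ ρ_L` for every observable level `y ≥ L`**: before
`ρ_L` the driver is bounded by `L/128` and `√(r ∧ ρ_L) ≤ L/128`, so `64 (L/128 + √(r ∧ ρ_L)) ≤ L ≤ y`.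
[folklore] -/
theorem farRegime_stopped_level (hWc : ∀ ω, Continuous (W · ω)) (hW0 : ∀ ω, W 0 ω = 0)
    {L y : ℝ} (hL : 0 < L) (hLy : L ≤ y) (r : ℝ≥0) (ω : Ω) :
    FarRegime (fun u ↦ W u ω) (I * y) (min (r : WithTop ℝ≥0) (farStopTime W L ω)).untopA
      (L / 128) := by
  set σ := (min (r : WithTop ℝ≥0) (farStopTime W L ω)).untopA with hσ
  have hσρ : (σ : WithTop ℝ≥0) ≤ farStopTime W L ω := coe_untopA_min_le r _
  have hy : 0 < y := hL.trans_le hLy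
  have hnorm : ‖I * (y : ℂ)‖ = y := by simp [abs_of_pos hy]
  obtain ⟨-, hsqrt⟩ := abs_le_and_sqrt_le_of_le_farStopTime hWc hW0 hL hσρ
  refine ⟨hWc ω, fun u hu ↦ ?_, ?_, by rw [hnorm]; exact hy⟩
  · have hu' : u.toNNReal ≤ σ := by
      have := Real.toNNReal_le_toNNReal hu.2
      rwa [Real.toNNReal_coe] at this
    exact (abs_le_and_sqrt_le_of_le_farStopTime hWc hW0 hL
      ((WithTop.coe_le_coe.2 hu').trans hσρ)).1
  · rw [hnorm]
    linarith

/-- The clock `r ∧ ρ_L` is at most CDHKS's time horizon `T(iy) = y²/9` for `y ≥ L > 0`.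
[folklore] -/
theorem untopA_min_farStopTime_le_cdhksTime (hWc : ∀ ω, Continuous (W · ω)) {L y : ℝ}
    (hL : 0 < L) (hLy : L ≤ y) (r : ℝ≥0) (ω : Ω) :
    (min (r : WithTop ℝ≥0) (farStopTime W L ω)).untopA ≤ cdhksTime y := by
  have h1 : ((min (r : WithTop ℝ≥0) (farStopTime W L ω)).untopA : WithTop ℝ≥0) ≤ cdhksTime L :=
    (coe_untopA_min_le r _).trans (farStopTime_le_cdhksTime hWc L ω)
  have h2 : cdhksTime L ≤ cdhksTime y := by
    rw [← NNReal.coe_le_coe, coe_cdhksTime, coe_cdhksTime]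
    have := mul_self_le_mul_self hL.le hLy
    nlinarith
  exact (WithTop.coe_le_coe.1 h1).trans h2

/-- **The time-limited spin observable at the clock `r ∧ ρ_L` is the principal-branch spin
observable there** (`y ≥ L > 0`): the clock is below the time horizon and the path is in the
far-field regime, where the continuous branch is the principal branch. [folklore] -/
theorem stoppedProcess_spinObservableProcess_level (hWc : ∀ ω, Continuous (W · ω))
    (hW0 : ∀ ω, W 0 ω = 0) {L y : ℝ} (hL : 0 < L) (hLy : L ≤ y) (r : ℝ≥0) (ω : Ω) :
    stoppedProcess (spinObservableProcess W y) (farStopTime W L) r ω =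
      spinObservable (fun u ↦ W u ω) (min (r : WithTop ℝ≥0) (farStopTime W L ω)).untopA (I * y) := by
  simp only [stoppedProcess, spinObservableProcess_apply]
  rw [min_eq_left (untopA_min_farStopTime_le_cdhksTime hWc hL hLy r ω)]
  exact (farRegime_stopped_level hWc hW0 hL hLy r ω).contSpinObservable_eq

/-- **Pathwise expansion of the spin observable at the clock `r ∧ ρ_L`, level `y ≥ L`**: with
`A = W_{r∧ρ_L}`, `σ = r ∧ ρ_L` and `r ≤ t`,
`‖N^y_{r∧ρ_L} - (1 + A/(iy) + (A² - 3σ)/(iy)²)‖ ≤ 300 ((L/128 + √t)/y)³` — a remainder of order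
`y⁻³` at FIXED localisation level `L`. [cite: CDHKSCRAS2014, §3 eq. (5)] -/
theorem norm_stoppedProcess_spinObservableProcess_sub_le (hWc : ∀ ω, Continuous (W · ω))
    (hW0 : ∀ ω, W 0 ω = 0) {L y : ℝ} (hL : 0 < L) (hLy : L ≤ y) {r t : ℝ≥0} (hr : r ≤ t)
    (ω : Ω) :
    ‖stoppedProcess (spinObservableProcess W y) (farStopTime W L) r ω -
        (1 + ((stoppedProcess W (farStopTime W L) r ω : ℝ) : ℂ) / (I * y) +
          (((stoppedProcess W (farStopTime W L) r ω : ℝ) : ℂ) ^ 2 -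
              3 * (((min (r : WithTop ℝ≥0) (farStopTime W L ω)).untopA : ℝ) : ℂ)) / (I * y) ^ 2)‖ ≤
      300 * ((L / 128 + Real.sqrt t) / y) ^ 3 := by
  have hreg := farRegime_stopped_level hWc hW0 hL hLy r ω
  have hy : 0 < y := hL.trans_le hLy
  set σ := (min (r : WithTop ℝ≥0) (farStopTime W L ω)).untopA with hσ
  have hσt : σ ≤ t := (untopA_min_coe_le r _).trans hr
  have hmain := hreg.norm_spinObservable_sub_le
  have hnorm : ‖I * (y : ℂ)‖ = y := by simp [abs_of_pos hy]
  rw [hnorm] at hmain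
  rw [stoppedProcess_spinObservableProcess_level hWc hW0 hL hLy r ω]
  refine (le_of_eq ?_).trans (hmain.trans ?_)
  · rfl
  · have hK : L / 128 + Real.sqrt σ ≤ L / 128 + Real.sqrt t := by gcongr
    have hK0 : 0 ≤ L / 128 + Real.sqrt σ := add_nonneg (by positivity) (Real.sqrt_nonneg _)
    gcongr

/-- **Imaginary part at the doubly stopped clock: `|Im N + A/y| ≤ 300 ((L/128 + √t)/y)³`.**
[folklore] -/
theorem abs_im_stoppedProcess_spinObservableProcess_add_le (hWc : ∀ ω, Continuous (W · ω))
    (hW0 : ∀ ω, W 0 ω = 0) {L y : ℝ} (hL : 0 < L) (hLy : L ≤ y) {r t : ℝ≥0} (hr : r ≤ t)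
    (ω : Ω) :
    |(stoppedProcess (spinObservableProcess W y) (farStopTime W L) r ω).im +
        stoppedProcess W (farStopTime W L) r ω / y| ≤
      300 * ((L / 128 + Real.sqrt t) / y) ^ 3 := by
  have hy : 0 < y := hL.trans_le hLy
  have h := norm_stoppedProcess_spinObservableProcess_sub_le hWc hW0 hL hLy hr ω
  rw [spin_main_term_eq hy.ne'] at h
  set a : ℝ := 1 - (stoppedProcess W (farStopTime W L) r ω ^ 2 -
      3 * ((min (r : WithTop ℝ≥0) (farStopTime W L ω)).untopA : ℝ)) / y ^ 2 with ha
  set b : ℝ := -stoppedProcess W (farStopTime W L) r ω / y with hb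
  set O := stoppedProcess (spinObservableProcess W y) (farStopTime W L) r ω with hO
  have him : (O - ((a : ℂ) + (b : ℂ) * I)).im = O.im + stoppedProcess W (farStopTime W L) r ω / y := by
    simp only [sub_im, add_im, ofReal_im, mul_im, ofReal_re, I_re, I_im, mul_zero, mul_one, zero_add,
      add_zero, hb]
    ring
  rw [← him]
  exact (abs_im_le_norm _).trans h

/-- **Real part at the doubly stopped clock: `|Re N - 1 + (A² - 3σ)/y²| ≤ 300 ((L/128 + √t)/y)³`.**
[folklore] -/
theorem abs_re_stoppedProcess_spinObservableProcess_sub_le (hWc : ∀ ω, Continuous (W · ω))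
    (hW0 : ∀ ω, W 0 ω = 0) {L y : ℝ} (hL : 0 < L) (hLy : L ≤ y) {r t : ℝ≥0} (hr : r ≤ t)
    (ω : Ω) :
    |(stoppedProcess (spinObservableProcess W y) (farStopTime W L) r ω).re - 1 +
        (stoppedProcess W (farStopTime W L) r ω ^ 2 -
          3 * ((min (r : WithTop ℝ≥0) (farStopTime W L ω)).untopA : ℝ)) / y ^ 2| ≤
      300 * ((L / 128 + Real.sqrt t) / y) ^ 3 := by
  have hy : 0 < y := hL.trans_le hLy
  have h := norm_stoppedProcess_spinObservableProcess_sub_le hWc hW0 hL hLy hr ω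
  rw [spin_main_term_eq hy.ne'] at h
  set a : ℝ := 1 - (stoppedProcess W (farStopTime W L) r ω ^ 2 -
      3 * ((min (r : WithTop ℝ≥0) (farStopTime W L ω)).untopA : ℝ)) / y ^ 2 with ha
  set b : ℝ := -stoppedProcess W (farStopTime W L) r ω / y with hb
  set O := stoppedProcess (spinObservableProcess W y) (farStopTime W L) r ω with hO
  have hre : (O - ((a : ℂ) + (b : ℂ) * I)).re = O.re - 1 +
      (stoppedProcess W (farStopTime W L) r ω ^ 2 -
        3 * ((min (r : WithTop ℝ≥0) (farStopTime W L ω)).untopA : ℝ)) / y ^ 2 := by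
    simp only [sub_re, add_re, ofReal_re, mul_re, ofReal_im, I_re, I_im, mul_zero, mul_one, sub_zero,
      ha]
    ring
  rw [← hre]
  exact (abs_re_le_norm _).trans h

end Expansion

/-! ### The two stopped martingales at a fixed level -/

section Stopped

variable {𝓕 : Filtration ℝ≥0 m} {P : Measure Ω} [IsProbabilityMeasure P]

/-- The stopped driver is integrable (bounded and strongly measurable). [folklore] -/
theorem integrable_stoppedProcess_farStopTime (hWad : StronglyAdapted 𝓕 W)
    (hWc : ∀ ω, Continuous (W · ω)) (hW0 : ∀ ω, W 0 ω = 0) {L : ℝ} (hL : 0 < L) (r : ℝ≥0) :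
    Integrable (stoppedProcess W (farStopTime W L) r) P := by
  refine (integrable_const (L / 128)).mono'
    (((stronglyAdapted_stoppedProcess_farStopTime hWad hWc L) r).mono (𝓕.le r)).aestronglyMeasurable
    (ae_of_all _ fun ω ↦ ?_)
  rw [Real.norm_eq_abs]
  exact abs_stoppedProcess_farStopTime_le hWc hW0 hL r ω

/-- `C / y ^ k → 0` as `y → ∞` (`k ≠ 0`). [folklore] -/
theorem tendsto_const_div_pow_atTop_nhds_zero (C : ℝ) {k : ℕ} (hk : k ≠ 0) :
    Tendsto (fun y : ℝ ↦ C / y ^ k) atTop (𝓝 0) :=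
  tendsto_const_nhds.div_atTop (tendsto_pow_atTop hk)

/-- **Order one, localised: the driver stopped at `ρ_L` is a martingale.** Let `W` be strongly
adapted with continuous paths and `W_0 = 0`, and suppose that for every level `y ≥ y₀` the
imaginary part of the time-limited spin observable `N^y = spinObservableProcess W y` is an
`𝓕`-martingale. Then for every `L > 0` the stopped driver `W^{ρ_L}`,
`ρ_L = farStopTime W L`, is an `𝓕`-martingale. Proof: optional stopping of `Im N^y` at `ρ_L`;
the general coefficient lemma `integral_abs_condExp_stoppedDriver_sub_le_of_coeff` applied to
`W^{ρ_L}` (bounded by the constant `L/128`) at level `L` with the rescaled martingale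
`(y/L) Im N^y_{·∧ρ_L}` and `K = 300 L²/y²` bounds the `L¹` defect of the martingale identity by
`600 (L/128 + √t)³/y²` for every `y ≥ max y₀ L`; let `y → ∞`. No moment hypothesis.
[cite: CDHKSCRAS2014, §3 (last paragraph)] -/
theorem martingale_stoppedDriver_of_spinObservable (hWad : StronglyAdapted 𝓕 W)
    (hWc : ∀ ω, Continuous (W · ω)) (hW0 : ∀ ω, W 0 ω = 0) {L : ℝ} (hL : 0 < L) {y₀ : ℝ}
    (him : ∀ y, y₀ ≤ y → Martingale (fun r ω ↦ (spinObservableProcess W y r ω).im) 𝓕 P) :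
    Martingale (stoppedProcess W (farStopTime W L)) 𝓕 P := by
  set ρ := farStopTime W L with hρ
  set V := stoppedProcess W ρ with hV
  have hVad : StronglyAdapted 𝓕 V := stronglyAdapted_stoppedProcess_farStopTime hWad hWc L
  have hVc : ∀ ω, Continuous (V · ω) := continuous_stoppedProcess_farStopTime hWc L
  have hVbd : ∀ r ω, |V r ω| ≤ L / 128 := abs_stoppedProcess_farStopTime_le hWc hW0 hL
  have hVint : ∀ r, Integrable (V r) P :=
    integrable_stoppedProcess_farStopTime hWad hWc hW0 hL
  have hVV : stoppedProcess V (farStopTime V L) = V :=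
    funext fun r ↦ funext fun ω ↦ stoppedProcess_stoppedProcess_farStopTime hWc L r ω
  set X : ℝ≥0 → ℝ := fun t ↦ (L / 128 + Real.sqrt t) ^ 3 with hX
  -- the defect bound at every large level `y`
  have key : ∀ s t : ℝ≥0, s ≤ t → ∀ y, max y₀ L ≤ y →
      ∫ ω, |(P[V t | 𝓕 s]) ω - V s ω| ∂P ≤ 600 * X t / y ^ 2 := by
    intro s t hst y hy
    have hLy : L ≤ y := (le_max_right _ _).trans hy
    have hy0y : y₀ ≤ y := (le_max_left _ _).trans hy
    have hy : 0 < y := hL.trans_le hLy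
    have hN : Martingale (stoppedProcess (fun r ω ↦ (spinObservableProcess W y r ω).im) ρ) 𝓕 P :=
      martingale_stoppedProcess_farStopTime hWad hWc L (him y hy0y)
        fun ω ↦ continuous_im.comp (continuous_spinObservableProcess hWc hy ω)
    set Oim : ℝ≥0 → Ω → ℝ :=
      (y / L) • stoppedProcess (fun r ω ↦ (spinObservableProcess W y r ω).im) ρ with hOim
    have hOm : Martingale Oim 𝓕 P := hN.smul _
    have hM : MemLp (fun _ : Ω ↦ L / 128) 3 P := memLp_const _
    have hbd : ∀ᵐ ω ∂P, ∀ u, u ≤ t → |V u ω| ≤ L / 128 := ae_of_all _ fun ω u _ ↦ hVbd u ω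
    have hcoef : ∀ᵐ ω ∂P, ∀ r, r ≤ t →
        |Oim r ω + 1 * stoppedProcess V (farStopTime V L) r ω / L| ≤
          300 * L ^ 2 / y ^ 2 * ((L / 128 + Real.sqrt t) / L) ^ 3 := by
      refine ae_of_all _ fun ω r hr ↦ ?_
      have h1 := abs_im_stoppedProcess_spinObservableProcess_add_le hWc hW0 hL hLy hr ω
      rw [stoppedProcess_stoppedProcess_farStopTime hWc L r ω]
      have heq : Oim r ω + 1 * stoppedProcess W (farStopTime W L) r ω / L =
          (y / L) * ((stoppedProcess (spinObservableProcess W y) (farStopTime W L) r ω).im +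
            stoppedProcess W (farStopTime W L) r ω / y) := by
        simp only [hOim, Pi.smul_apply, smul_eq_mul, stoppedProcess, hρ]
        field_simp
      rw [heq, abs_mul, abs_of_pos (div_pos hy hL)]
      calc y / L * |(stoppedProcess (spinObservableProcess W y) (farStopTime W L) r ω).im +
              stoppedProcess W (farStopTime W L) r ω / y|
          ≤ y / L * (300 * ((L / 128 + Real.sqrt t) / y) ^ 3) := by gcongr
        _ = 300 * L ^ 2 / y ^ 2 * ((L / 128 + Real.sqrt t) / L) ^ 3 := by
          field_simp
    have h := integral_abs_condExp_stoppedDriver_sub_le_of_coeff hVad hVc hL one_ne_zero hOm hst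
      hM (fun _ ↦ by positivity) hbd hcoef
    rw [hVV] at h
    refine h.trans (le_of_eq ?_)
    rw [integral_const, smul_eq_mul, abs_one, one_mul]
    simp only [probReal_univ, one_mul, hX]
    field_simp
    norm_num
  refine ⟨hVad, fun s t hst ↦ ?_⟩
  refine condExp_ae_eq_of_approx (hVint t) (hVint s) fun ε hε ↦
    ⟨V t, V s, hVint t, hVint s, by simp [hε.le], by simp [hε.le], ?_⟩
  have hc := tendsto_const_div_pow_atTop_nhds_zero (600 * X t) two_ne_zero
  obtain ⟨y, hy1, hy2⟩ := ((eventually_ge_atTop (max y₀ L)).and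
    (hc.eventually (Iic_mem_nhds hε))).exists
  exact (key s t hst y hy1).trans hy2

/-- The clock `r ↦ r ∧ ρ_L` (read in `ℝ`) is strongly adapted. [folklore] -/
theorem stronglyAdapted_stoppedClock_farStopTime (hWad : StronglyAdapted 𝓕 W)
    (hWc : ∀ ω, Continuous (W · ω)) (L : ℝ) :
    StronglyAdapted 𝓕 (fun (r : ℝ≥0) (ω : Ω) ↦
      (((min (r : WithTop ℝ≥0) (farStopTime W L ω)).untopA : ℝ≥0) : ℝ)) := by
  have hclock : StronglyAdapted 𝓕 (fun (u : ℝ≥0) (_ : Ω) ↦ (u : ℝ)) := fun _ ↦ stronglyMeasurable_const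
  exact hclock.stoppedProcess (fun _ ↦ NNReal.continuous_coe) (isStoppingTime_farStopTime hWad hWc L)

/-- **Order two, localised: `(W^{ρ_L})² - 3 (· ∧ ρ_L)` is a martingale.** Same setting, with the
real parts of `N^y` martingales for `y ≥ y₀`: for every `L > 0`,
`r ↦ (W_{r∧ρ_L})² - 3 (r ∧ ρ_L)` is an `𝓕`-martingale. Proof: the general coefficient lemma
`integral_abs_condExp_stoppedQuad_sub_le_of_coeff` for `W^{ρ_L}` at level `L` with the rescaled
martingale `1 + (y/L)² (Re N^y_{·∧ρ_L} - 1)` and `K = 300 L/y`: defect `≤ 600 (L/128 + √t)³/y → 0`.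
No moment hypothesis. [cite: CDHKSCRAS2014, §3 (last paragraph)] -/
theorem martingale_stoppedQuad_of_spinObservable (hWad : StronglyAdapted 𝓕 W)
    (hWc : ∀ ω, Continuous (W · ω)) (hW0 : ∀ ω, W 0 ω = 0) {L : ℝ} (hL : 0 < L) {y₀ : ℝ}
    (hre : ∀ y, y₀ ≤ y → Martingale (fun r ω ↦ (spinObservableProcess W y r ω).re) 𝓕 P) :
    Martingale (fun r ω ↦ stoppedProcess W (farStopTime W L) r ω ^ 2 -
      3 * (((min (r : WithTop ℝ≥0) (farStopTime W L ω)).untopA : ℝ≥0) : ℝ)) 𝓕 P := by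
  set ρ := farStopTime W L with hρ
  set V := stoppedProcess W ρ with hV
  have hVad : StronglyAdapted 𝓕 V := stronglyAdapted_stoppedProcess_farStopTime hWad hWc L
  have hVc : ∀ ω, Continuous (V · ω) := continuous_stoppedProcess_farStopTime hWc L
  have hVbd : ∀ r ω, |V r ω| ≤ L / 128 := abs_stoppedProcess_farStopTime_le hWc hW0 hL
  have hVV : stoppedProcess V (farStopTime V L) = V :=
    funext fun r ↦ funext fun ω ↦ stoppedProcess_stoppedProcess_farStopTime hWc L r ω
  have hρρ : farStopTime V L = ρ := funext fun ω ↦ farStopTime_stoppedProcess_self hWc L ω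
  set Q : ℝ≥0 → Ω → ℝ := fun r ω ↦ V r ω ^ 2 -
    3 * (((min (r : WithTop ℝ≥0) (ρ ω)).untopA : ℝ≥0) : ℝ) with hQ
  have hQad : StronglyAdapted 𝓕 Q := fun r ↦
    ((hVad r).pow 2).sub ((stronglyAdapted_stoppedClock_farStopTime hWad hWc L r).const_mul 3)
  have hM : MemLp (fun _ : Ω ↦ L / 128) 3 P := memLp_const _
  have hM2 : Integrable (fun _ : Ω ↦ (L / 128) ^ 2) P := integrable_const _
  have hQint : ∀ r, Integrable (Q r) P := by
    intro r
    have hbd : ∀ᵐ ω ∂P, ∀ u, u ≤ r → |V u ω| ≤ L / 128 := ae_of_all _ fun ω u _ ↦ hVbd u ω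
    have := integrable_stoppedQuad' hVad hVc hM2 hbd le_rfl L 3
    rwa [hVV, hρρ] at this
  set X : ℝ≥0 → ℝ := fun t ↦ (L / 128 + Real.sqrt t) ^ 3 with hX
  have key : ∀ s t : ℝ≥0, s ≤ t → ∀ y, max y₀ L ≤ y →
      ∫ ω, |(P[Q t | 𝓕 s]) ω - Q s ω| ∂P ≤ 600 * X t / y := by
    intro s t hst y hy
    have hLy : L ≤ y := (le_max_right _ _).trans hy
    have hy0y : y₀ ≤ y := (le_max_left _ _).trans hy
    have hy : 0 < y := hL.trans_le hLy
    have hN : Martingale (stoppedProcess (fun r ω ↦ (spinObservableProcess W y r ω).re) ρ) 𝓕 P :=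
      martingale_stoppedProcess_farStopTime hWad hWc L (hre y hy0y)
        fun ω ↦ continuous_re.comp (continuous_spinObservableProcess hWc hy ω)
    set Ore : ℝ≥0 → Ω → ℝ := (fun _ _ ↦ (1 : ℝ)) +
      (y ^ 2 / L ^ 2) • (stoppedProcess (fun r ω ↦ (spinObservableProcess W y r ω).re) ρ -
        fun _ _ ↦ (1 : ℝ)) with hOre
    have hOm : Martingale Ore 𝓕 P :=
      (martingale_const 𝓕 P (1 : ℝ)).add ((hN.sub (martingale_const 𝓕 P (1 : ℝ))).smul _)
    have hbd : ∀ᵐ ω ∂P, ∀ u, u ≤ t → |V u ω| ≤ L / 128 := ae_of_all _ fun ω u _ ↦ hVbd u ω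
    have hcoef : ∀ᵐ ω ∂P, ∀ r, r ≤ t →
        |Ore r ω - 1 + 1 * (stoppedProcess V (farStopTime V L) r ω ^ 2 -
          3 * (((min (r : WithTop ℝ≥0) (farStopTime V L ω)).untopA : ℝ≥0) : ℝ)) / L ^ 2| ≤
          300 * L / y * ((L / 128 + Real.sqrt t) / L) ^ 3 := by
      refine ae_of_all _ fun ω r hr ↦ ?_
      have h1 := abs_re_stoppedProcess_spinObservableProcess_sub_le hWc hW0 hL hLy hr ω
      rw [stoppedProcess_stoppedProcess_farStopTime hWc L r ω, farStopTime_stoppedProcess_self hWc L ω]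
      have heq : Ore r ω - 1 + 1 * (stoppedProcess W (farStopTime W L) r ω ^ 2 -
            3 * (((min (r : WithTop ℝ≥0) (farStopTime W L ω)).untopA : ℝ≥0) : ℝ)) / L ^ 2 =
          (y ^ 2 / L ^ 2) * ((stoppedProcess (spinObservableProcess W y) (farStopTime W L) r ω).re - 1 +
            (stoppedProcess W (farStopTime W L) r ω ^ 2 -
              3 * (((min (r : WithTop ℝ≥0) (farStopTime W L ω)).untopA : ℝ≥0) : ℝ)) / y ^ 2) := by
        simp only [hOre, Pi.add_apply, Pi.smul_apply, Pi.sub_apply, smul_eq_mul, stoppedProcess, hρ]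
        field_simp
        ring
      rw [heq, abs_mul, abs_of_pos (by positivity : (0 : ℝ) < y ^ 2 / L ^ 2)]
      calc y ^ 2 / L ^ 2 * |(stoppedProcess (spinObservableProcess W y) (farStopTime W L) r ω).re - 1 +
              (stoppedProcess W (farStopTime W L) r ω ^ 2 -
                3 * (((min (r : WithTop ℝ≥0) (farStopTime W L ω)).untopA : ℝ≥0) : ℝ)) / y ^ 2|
          ≤ y ^ 2 / L ^ 2 * (300 * ((L / 128 + Real.sqrt t) / y) ^ 3) := by gcongr
        _ = 300 * L / y * ((L / 128 + Real.sqrt t) / L) ^ 3 := by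
          field_simp
    have h := integral_abs_condExp_stoppedQuad_sub_le_of_coeff hVad hVc (κ := 3) hL one_ne_zero
      hOm hst hM (fun _ ↦ by positivity) hbd hcoef
    rw [hVV, hρρ] at h
    refine h.trans (le_of_eq ?_)
    rw [integral_const, smul_eq_mul, abs_one, one_mul]
    simp only [probReal_univ, one_mul, hX]
    field_simp
    norm_num
  refine ⟨hQad, fun s t hst ↦ ?_⟩
  refine condExp_ae_eq_of_approx (hQint t) (hQint s) fun ε hε ↦
    ⟨Q t, Q s, hQint t, hQint s, by simp [hε.le], by simp [hε.le], ?_⟩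
  have hc := tendsto_const_div_pow_atTop_nhds_zero (600 * X t) one_ne_zero
  simp only [pow_one] at hc
  obtain ⟨y, hy1, hy2⟩ := ((eventually_ge_atTop (max y₀ L)).and
    (hc.eventually (Iic_mem_nhds hε))).exists
  exact (key s t hst y hy1).trans hy2

end Stopped

/-! ### Local martingales and Lévy's format -/

section Local

variable {𝓕 : Filtration ℝ≥0 m} {P : Measure Ω} [IsProbabilityMeasure P]

/-- For a positive level the indicator `𝟙_{⊥ < ρ_L}` of Mathlib's `Locally` is identically one.
[folklore] -/
theorem indicator_bot_lt_farStopTime (hWc : ∀ ω, Continuous (W · ω)) (hW0 : ∀ ω, W 0 ω = 0)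
    {L : ℝ} (hL : 0 < L) (X : ℝ≥0 → Ω → ℝ) :
    (fun i ↦ {ω | ⊥ < farStopTime W L ω}.indicator (X i)) = X := by
  funext i ω
  exact indicator_of_mem (show ω ∈ {ω | ⊥ < farStopTime W L ω} from
    bot_lt_farStopTime hWc hW0 hL ω) (X i)

/-- **The driver and `W² - 3t` are local martingales** (localising sequence `ρ_{n+1}`): `W`
strongly adapted with continuous paths, `W_0 = 0`, and the real and imaginary parts of the
time-limited spin observable `N^y` martingales for all `y ≥ y₀`. No moment hypothesis.
[cite: CDHKSCRAS2014, §3 (last paragraph)] -/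
theorem isLocalMartingale_driver_of_spinObservable (hWad : StronglyAdapted 𝓕 W)
    (hWc : ∀ ω, Continuous (W · ω)) (hW0 : ∀ ω, W 0 ω = 0) {y₀ : ℝ}
    (hre : ∀ y, y₀ ≤ y → Martingale (fun r ω ↦ (spinObservableProcess W y r ω).re) 𝓕 P)
    (him : ∀ y, y₀ ≤ y → Martingale (fun r ω ↦ (spinObservableProcess W y r ω).im) 𝓕 P) :
    IsLocalMartingale W 𝓕 P ∧
      IsLocalMartingale (fun t ω ↦ W t ω ^ 2 - 3 * (t : ℝ)) 𝓕 P := by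
  have hloc := isLocalizingSequence_farStopTime hWad hWc (P := P)
  have hLn : ∀ n : ℕ, (0 : ℝ) < n + 1 := fun n ↦ by positivity
  constructor
  · unfold IsLocalMartingale
    refine ⟨_, hloc, fun n ↦ ?_⟩
    rw [indicator_bot_lt_farStopTime hWc hW0 (hLn n)]
    exact martingale_stoppedDriver_of_spinObservable hWad hWc hW0 (hLn n) him
  · unfold IsLocalMartingale
    refine ⟨_, hloc, fun n ↦ ?_⟩
    rw [indicator_bot_lt_farStopTime hWc hW0 (hLn n)]
    have h := martingale_stoppedQuad_of_spinObservable hWad hWc hW0 (hLn n) hre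
    have heq : stoppedProcess (fun t ω ↦ W t ω ^ 2 - 3 * (t : ℝ)) (farStopTime W ((n : ℝ) + 1)) =
        fun r ω ↦ stoppedProcess W (farStopTime W ((n : ℝ) + 1)) r ω ^ 2 -
          3 * (((min (r : WithTop ℝ≥0) (farStopTime W ((n : ℝ) + 1) ω)).untopA : ℝ≥0) : ℝ) := by
      funext r ω
      simp only [stoppedProcess]
    rw [heq]
    exact h

/-- **Lévy's format: `X = W/√3` is a continuous local martingale with `⟨X⟩_t = t`**, from the
martingale property of the time-limited spin observables at all large levels; no moment
hypothesis (the input of `Process.levy_characterisation` with `κ = 3`, hence of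
`isSLELaw_of_isLocalMartingale_driving_of_lt_four`). [cite: CDHKSCRAS2014, §3 (last paragraph)] -/
theorem isLocalMartingale_hasQuadraticVariation_of_spinObservable (hWad : StronglyAdapted 𝓕 W)
    (hWc : ∀ ω, Continuous (W · ω)) (hW0 : ∀ ω, W 0 ω = 0) {y₀ : ℝ}
    (hre : ∀ y, y₀ ≤ y → Martingale (fun r ω ↦ (spinObservableProcess W y r ω).re) 𝓕 P)
    (him : ∀ y, y₀ ≤ y → Martingale (fun r ω ↦ (spinObservableProcess W y r ω).im) 𝓕 P) :
    IsLocalMartingale (fun t ω ↦ (Real.sqrt 3)⁻¹ * W t ω) 𝓕 P ∧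
      HasQuadraticVariation (fun t ω ↦ (Real.sqrt 3)⁻¹ * W t ω) (fun t _ ↦ (t : ℝ)) 𝓕 P := by
  have hloc := isLocalizingSequence_farStopTime hWad hWc (P := P)
  have hLn : ∀ n : ℕ, (0 : ℝ) < n + 1 := fun n ↦ by positivity
  have h1 : IsLocalMartingale (fun t ω ↦ (Real.sqrt 3)⁻¹ * W t ω) 𝓕 P := by
    unfold IsLocalMartingale
    refine ⟨_, hloc, fun n ↦ ?_⟩
    rw [indicator_bot_lt_farStopTime hWc hW0 (hLn n)]
    have h := (martingale_stoppedDriver_of_spinObservable hWad hWc hW0 (hLn n) him).smul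
      (Real.sqrt 3)⁻¹
    have heq : stoppedProcess (fun t ω ↦ (Real.sqrt 3)⁻¹ * W t ω) (farStopTime W ((n : ℝ) + 1)) =
        (Real.sqrt 3)⁻¹ • stoppedProcess W (farStopTime W ((n : ℝ) + 1)) := by
      funext r ω
      simp only [stoppedProcess, Pi.smul_apply, smul_eq_mul]
    rw [heq]
    exact h
  have h2 : IsLocalMartingale (fun t ω ↦ ((Real.sqrt 3)⁻¹ * W t ω) ^ 2 - (t : ℝ)) 𝓕 P := by
    unfold IsLocalMartingale
    refine ⟨_, hloc, fun n ↦ ?_⟩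
    rw [indicator_bot_lt_farStopTime hWc hW0 (hLn n)]
    have h := (martingale_stoppedQuad_of_spinObservable hWad hWc hW0 (hLn n) hre).smul (3 : ℝ)⁻¹
    have heq : stoppedProcess (fun t ω ↦ ((Real.sqrt 3)⁻¹ * W t ω) ^ 2 - (t : ℝ))
          (farStopTime W ((n : ℝ) + 1)) =
        (3 : ℝ)⁻¹ • fun r ω ↦ stoppedProcess W (farStopTime W ((n : ℝ) + 1)) r ω ^ 2 -
          3 * (((min (r : WithTop ℝ≥0) (farStopTime W ((n : ℝ) + 1) ω)).untopA : ℝ≥0) : ℝ) := by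
      funext r ω
      simp only [stoppedProcess, Pi.smul_apply, smul_eq_mul]
      rw [mul_pow, inv_pow, Real.sq_sqrt (by norm_num : (0 : ℝ) ≤ 3)]
      ring
    rw [heq]
    exact h
  exact ⟨h1,
    { adapted := fun _ ↦ measurable_const
      continuous := ae_of_all _ fun _ ↦ NNReal.continuous_coe
      monotone := ae_of_all _ fun _ _ _ h ↦ NNReal.coe_le_coe.2 h
      zero := fun _ ↦ NNReal.coe_zero
      isLocalMartingale := h2 }⟩

/-- **CDHKS §3 from the cylinder identity, moment-free, local form.** Let `W` be a real process
indexed by `[0, ∞)` with strongly measurable coordinates, continuous paths and `W_0 = 0`, and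
suppose that for every `y > 0` the time-limited spin observable `N^y = spinObservableProcess W y`
satisfies the cylinder identity `E[(N^y_t - N^y_s) ψ(W_{S_0}, …, W_{S_{n-1}})] = 0` for all
`s ≤ t`, all finite families of times `S_k ≤ s` and all continuous `ψ` with `|ψ| ≤ 1` (the
monotone-class form of "`M_t(z)`, `t ≤ T(z)`, is a martingale with respect to the filtration
generated by `W_t`"). Then `W/√3` is a continuous local martingale with quadratic variation `t`
in the natural filtration of `W`. This is `martingale_driver_of_spinCylinderIdentity` WITHOUT its
`L³` running-supremum hypothesis (CDHKS Thm. 3's exponential moments are not needed), with the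
conclusion in the format of Lévy's characterisation. PROVED.
[cite: CDHKSCRAS2014, §3 (proof of Thm. 1, last paragraph)] -/
theorem isLocalMartingale_hasQuadraticVariation_of_spinCylinderIdentity
    (hW : ∀ t, StronglyMeasurable (W t)) (hWc : ∀ ω, Continuous (W · ω)) (hW0 : ∀ ω, W 0 ω = 0)
    (hcyl : ∀ y : ℝ, 0 < y → ∀ s t : ℝ≥0, s ≤ t → ∀ (n : ℕ) (S : Fin n → ℝ≥0), (∀ k, S k ≤ s) →
      ∀ ψ : (Fin n → ℝ) → ℝ, Continuous ψ → (∀ v, |ψ v| ≤ 1) →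
        ∫ ω, (spinObservableProcess W y t ω - spinObservableProcess W y s ω) *
          (ψ (fun k ↦ W (S k) ω) : ℂ) ∂P = 0) :
    IsLocalMartingale (fun t ω ↦ (Real.sqrt 3)⁻¹ * W t ω) (Filtration.natural W hW) P ∧
      HasQuadraticVariation (fun t ω ↦ (Real.sqrt 3)⁻¹ * W t ω) (fun t _ ↦ (t : ℝ))
        (Filtration.natural W hW) P := by
  have hWad : StronglyAdapted (Filtration.natural W hW) W := Filtration.stronglyAdapted_natural hW
  refine isLocalMartingale_hasQuadraticVariation_of_spinObservable hWad hWc hW0 (y₀ := 1)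
    (fun y hy ↦ ?_) (fun y hy ↦ ?_)
  · have hy0 : 0 < y := by linarith
    exact (martingale_re_im_spinObservableProcess_of_cylinder hW hWc hy0 (hcyl y hy0)).1
  · have hy0 : 0 < y := by linarith
    exact (martingale_re_im_spinObservableProcess_of_cylinder hW hWc hy0 (hcyl y hy0)).2

end Local

end Loewner

end Literature.Probability.RandomPlanarGeometry
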